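import Summits.QuantumFields.YangMills.Theorems.LuscherReductionDressedRitzRitzAlgebra
import Literature.Analysis.OperatorTheory.ClusterKatoTempleBound
import HarnessLib

/-!
# Route `LuscherReduction`, item `DressedRitz` (stmt-QuantumFields-20205) — reduction chain, file B:
# LEMMA B — Ritz values from near-diagonal generator data, second order (generic real vector space)

Support module of the `FemtoTransferGap` group (fleet service by seat ym-infvol-p2 g6; route `LuscherReduction`, femto rung R2b1; bears on the
crux child `DressedRitz` = stmt-QuantumFields-20205 of RED stmt-QuantumFields-19978).  CONTENT = §6 of the planner's crux workfile
`Summits/QuantumFields/YangMills/Cruxes/RunningReduction/Lines/DressedRitzGEVP.lean` (rev 3, sha16 8eae6de8b30412fb, seat ym-cruxidea-19978-1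
GEN 4; kernel-checked there) RE-HOMED VERBATIM on the Theorems side (namespace `…Theorems.FemtoTransferGap.KTGen`; the `maxHeartbeats` bump of
the workfile is not needed and dropped), because Cruxes workfiles are not importable on the farm.

`ritz_near_diagonal`: unit generators `v_0 … v_{n−1}` with antitone diagonal data `d_i = E(v_i,v_i)`, near-orthogonality `|ip(v_i,v_l)| ≤ ε`
and symmetrised couplings `|E(v_i,v_l) − ½(d_i+d_l)·ip(v_i,v_l)| ≤ τ` (`i ≠ l`), spread `|d_i − d_l| ≤ σ`; `u, m` ANY `ip`-orthonormal
`E`-diagonal antitone basis of the same span (the Ritz basis; `m_j` = the in-span min–max values).  Then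
`|m_j − d_j| ≤ (nτ + 2n²σε²)/(1 − nε)` — first order in `τ`, SECOND order in `ε`, no cluster structure or gaps needed.  Upper half:
`exists_rayleigh_ge_of_constraints` (Literature `ClusterKatoTempleBound`) with the constraints `ip(v_i,·)`, `i < j`, +
`quadForm_upper_of_constraints` (file A); lower half: a kernel vector in `span{v_0..v_j}` killing `ip(u_i,·)`, `i < j`, +
`rayleigh_le_of_mem_span_of_orthogonal` + `quadForm_lower_of_nonneg`.

HONEST FRAMING: linear-algebra bookkeeping for the femto rung R2b1; proves nothing OF `DressedRitz`; no bearing on infinite volume, the continuum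
limit or the Clay gap.  References: Golub–Van Loan §8.1 [cite: GolubVanLoan2013, §8.1.1]; Lüscher–Wolff (GEVP effective masses)
[cite: LuscherWolff1990]; Reed–Simon IV XIII.1–2 [cite: ReedSimonIV1978, XIII.1].
-/

set_option autoImplicit false

noncomputable section

open scoped BigOperators

namespace Summit.QuantumFields.YangMills.Theorems.FemtoTransferGap.KTGen

open Literature.Analysis.OperatorTheory
open Literature.Analysis.OperatorTheory.ClusterKatoTemple

section LemmaB

variable {D : Type*} [AddCommGroup D] [Module ℝ D]

/-- **LEMMA B (Ritz values from near-diagonal data, second order)**: `|m_j − d_j| ≤ (nτ + 2n²σε²)/(1 − nε)` for the in-span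
min–max values `m` of unit generators with near-diagonal `ip`/`E` data (see the module docstring). [folklore] -/
theorem ritz_near_diagonal (ip E : D →ₗ[ℝ] D →ₗ[ℝ] ℝ)
    {n : ℕ} (v : Fin n → D) (d : Fin n → ℝ) (hd : ∀ i, E (v i) (v i) = d i) (hd_anti : Antitone d)
    (hunit : ∀ i, ip (v i) (v i) = 1) {ε τ σ : ℝ} (hε : 0 ≤ ε) (hτ : 0 ≤ τ) (hnε : (n : ℝ) * ε < 1)
    (hG : ∀ i l, i ≠ l → |ip (v i) (v l)| ≤ ε)
    (hS : ∀ i l, i ≠ l → |E (v i) (v l) - (d i + d l) / 2 * ip (v i) (v l)| ≤ τ)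
    (hσ : ∀ i l, |d i - d l| ≤ σ)
    (u : Fin n → D) (m : Fin n → ℝ) (hm : Antitone m)
    (huv : ∀ i, u i ∈ Submodule.span ℝ (Set.range v)) (hvu : ∀ i, v i ∈ Submodule.span ℝ (Set.range u))
    (hon : ∀ i l, ip (u i) (u l) = if i = l then 1 else 0)
    (hdiag : ∀ i l, E (u i) (u l) = if i = l then m i else 0) (j : Fin n) :
    |m j - d j| ≤ ((n : ℝ) * τ + 2 * (n : ℝ) ^ 2 * σ * ε ^ 2) / (1 - (n : ℝ) * ε) := by
  classical
  -- all-(i,l) forms of the tolerances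
  have hG' : ∀ i l, |ip (v i) (v l) - (if i = l then 1 else 0)| ≤ ε := by
    intro i l
    by_cases hil : i = l
    · subst hil; simp [hunit, hε]
    · simpa [hil] using hG i l hil
  have hS' : ∀ i l, |E (v i) (v l) - (d i + d l) / 2 * ip (v i) (v l)| ≤ τ := by
    intro i l
    by_cases hil : i = l
    · subst hil; rw [hd, hunit]; ring_nf; simpa using hτ
    · exact hS i l hil
  have hσ0 : 0 ≤ σ := by simpa using hσ j j
  set θ : ℝ := 1 - (n : ℝ) * ε with hθ
  have hθ0 : 0 < θ := by rw [hθ]; linarith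
  set δ : ℝ := (n : ℝ) * τ + 2 * (n : ℝ) ^ 2 * σ * ε ^ 2 with hδ
  have hδ0 : 0 ≤ δ := by rw [hδ]; positivity
  have hjn : (j : ℕ) < n := j.isLt
  have hspan_uv : Submodule.span ℝ (Set.range u) ≤ Submodule.span ℝ (Set.range v) :=
    Submodule.span_le.mpr (Set.range_subset_iff.mpr huv)
  have hspan_vu : Submodule.span ℝ (Set.range v) ≤ Submodule.span ℝ (Set.range u) :=
    Submodule.span_le.mpr (Set.range_subset_iff.mpr hvu)
  rw [abs_le]
  constructor
  · ------------------------------------------------------------------ LOWER: m_j ≥ d_j − δ/θ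
    -- the first `j+1` generators
    have hjn1 : (j : ℕ) + 1 ≤ n := hjn
    set w : Fin ((j : ℕ) + 1) → D := fun k => v (Fin.castLE hjn1 k) with hw
    -- a non-trivial combination annihilated by `ip(u_i, ·)`, `i < j`
    have hker : LinearMap.ker (Matrix.mulVecLin
        (Matrix.of fun (l : Fin (j : ℕ)) (k : Fin ((j : ℕ) + 1)) =>
          ip (u (Fin.castLE (le_of_lt hjn) l)) (w k))) ≠ ⊥ := by
      apply LinearMap.ker_ne_bot_of_finrank_lt
      simp only [Module.finrank_fin_fun]
      omega
    obtain ⟨g, hg, hg0⟩ := (Submodule.ne_bot_iff _).mp hker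
    rw [LinearMap.mem_ker, Matrix.mulVecLin_apply] at hg
    set x₀ : D := ∑ k, g k • w k with hx₀
    have hperp0 : ∀ l : Fin (j : ℕ), ip (u (Fin.castLE (le_of_lt hjn) l)) x₀ = 0 := by
      intro l
      have h := congr_fun hg l
      rw [Pi.zero_apply, Matrix.mulVec, dotProduct] at h
      rw [hx₀, map_sum]
      simp only [map_smul, smul_eq_mul]
      calc ∑ k, g k * ip (u (Fin.castLE (le_of_lt hjn) l)) (w k)
          = ∑ k, (Matrix.of fun (l : Fin (j : ℕ)) (k : Fin ((j : ℕ) + 1)) =>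
              ip (u (Fin.castLE (le_of_lt hjn) l)) (w k)) l k * g k := by
            refine Finset.sum_congr rfl fun k _ => ?_
            rw [Matrix.of_apply]; ring
        _ = 0 := h
    have hperp : ∀ i : Fin n, i.val < (j : ℕ) → ip (u i) x₀ = 0 := by
      intro i hi
      have h := hperp0 ⟨i.val, hi⟩
      have : Fin.castLE (le_of_lt hjn) ⟨i.val, hi⟩ = i := Fin.ext rfl
      rwa [this] at h
    have hx₀v : x₀ ∈ Submodule.span ℝ (Set.range v) := by
      refine Submodule.sum_mem _ fun k _ => Submodule.smul_mem _ _ ?_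
      exact Submodule.subset_span (Set.mem_range_self _)
    have hx₀u : x₀ ∈ Submodule.span ℝ (Set.range u) := hspan_vu hx₀v
    -- u-side: E(x₀,x₀) ≤ m_j · ip(x₀,x₀)
    have hup : E x₀ x₀ ≤ m j * ip x₀ x₀ :=
      rayleigh_le_of_mem_span_of_orthogonal ip E u m hon hdiag
        (fun i hi => hm (show j ≤ i from Fin.le_def.mpr hi)) hx₀u hperp
    -- v-side data for the subfamily `w`
    have hip₀ : ip x₀ x₀ = ∑ k, ∑ k', g k * g k' * ip (w k) (w k') := by
      rw [hx₀, bilin_sum_smul_sum_smul]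
    have hE₀ : E x₀ x₀ = ∑ k, ∑ k', g k * g k' * E (w k) (w k') := by
      rw [hx₀, bilin_sum_smul_sum_smul]
    have hGw : ∀ k k', |ip (w k) (w k') - (if k = k' then 1 else 0)| ≤ ε := by
      intro k k'
      have := hG' (Fin.castLE hjn1 k) (Fin.castLE hjn1 k')
      simpa only [hw, (Fin.castLE_injective hjn1).eq_iff] using this
    have hSw : ∀ k k', |E (w k) (w k') - (d (Fin.castLE hjn1 k) + d (Fin.castLE hjn1 k')) / 2 * ip (w k) (w k')| ≤ τ :=
      fun k k' => hS' _ _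
    have haw : ∀ k, 0 ≤ d (Fin.castLE hjn1 k) - d j := by
      intro k
      have hk : Fin.castLE hjn1 k ≤ j := by
        rw [Fin.le_def]; simpa [Fin.val_castLE] using Nat.lt_succ_iff.mp k.isLt
      linarith [hd_anti hk]
    have hσw : ∀ k, d (Fin.castLE hjn1 k) - d j ≤ σ := fun k => (le_abs_self _).trans (hσ _ _)
    have hlow := quadForm_lower_of_nonneg (fun k k' => E (w k) (w k')) (fun k k' => ip (w k) (w k'))
      (fun k => d (Fin.castLE hjn1 k)) g (d j) ε τ σ hGw hSw haw hσw
    have hgram := gram_lower (fun k k' => ip (w k) (w k')) g ε hε hGw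
    have hcs := sq_sum_abs_le_card_mul_sum_sq g
    simp only [Fintype.card_fin] at hlow hgram hcs
    -- the quadratic form with `t = d_j` is `E₀ − d_j ip₀`
    have hX : ∑ k, ∑ k', g k * g k' * (E (w k) (w k') - d j * ip (w k) (w k'))
        = E x₀ x₀ - d j * ip x₀ x₀ := by
      rw [hE₀, hip₀, Finset.mul_sum, ← Finset.sum_sub_distrib]
      refine Finset.sum_congr rfl fun k _ => ?_
      rw [Finset.mul_sum, ← Finset.sum_sub_distrib]
      refine Finset.sum_congr rfl fun k' _ => ?_
      ring
    rw [hX] at hlow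
    rw [← hip₀] at hgram
    -- positivity of `Σ g_k²`
    have hgpos : 0 < ∑ k, g k ^ 2 := by
      obtain ⟨k, hk⟩ : ∃ k, g k ≠ 0 := by
        by_contra h
        push Not at h
        exact hg0 (funext fun k => by rw [h k, Pi.zero_apply])
      exact lt_of_lt_of_le (by positivity) (Finset.single_le_sum (fun k _ => sq_nonneg (g k)) (Finset.mem_univ k))
    -- sizes: (j+1) ≤ n
    have hj1n : ((j : ℕ) + 1 : ℝ) ≤ n := by exact_mod_cast hjn1
    have hj1 : (0 : ℝ) ≤ ((j : ℕ) + 1 : ℝ) := by positivity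
    have hθj : θ ≤ 1 - ((j : ℕ) + 1 : ℝ) * ε := by
      rw [hθ]; nlinarith [mul_le_mul_of_nonneg_right hj1n hε]
    -- ip₀ ≥ θ Σ g² > 0
    have hipθ : θ * ∑ k, g k ^ 2 ≤ ip x₀ x₀ := by
      have := mul_le_mul_of_nonneg_right hθj hgpos.le
      push_cast at hgram this ⊢
      linarith
    have hippos : 0 < ip x₀ x₀ := lt_of_lt_of_le (mul_pos hθ0 hgpos) hipθ
    -- the error term is ≤ δ Σ g² ≤ (δ/θ) ip₀
    have hB2 : (∑ k, |g k|) ^ 2 ≤ (n : ℝ) * ∑ k, g k ^ 2 := by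
      push_cast at hcs
      exact hcs.trans (mul_le_mul_of_nonneg_right hj1n hgpos.le)
    have herr : (τ + ε ^ 2 * σ * ((j : ℕ) + 1 : ℝ) / 4) * (∑ k, |g k|) ^ 2 ≤ δ * ∑ k, g k ^ 2 := by
      have hc1 : τ + ε ^ 2 * σ * ((j : ℕ) + 1 : ℝ) / 4 ≤ τ + 2 * (n : ℝ) * σ * ε ^ 2 := by
        nlinarith [mul_le_mul_of_nonneg_right hj1n (show 0 ≤ ε ^ 2 * σ by positivity), show (0:ℝ) ≤ n * (ε ^ 2 * σ) by positivity]
      have hc0 : 0 ≤ τ + ε ^ 2 * σ * ((j : ℕ) + 1 : ℝ) / 4 := by positivity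
      calc _ ≤ (τ + 2 * (n : ℝ) * σ * ε ^ 2) * (∑ k, |g k|) ^ 2 := mul_le_mul_of_nonneg_right hc1 (sq_nonneg _)
        _ ≤ (τ + 2 * (n : ℝ) * σ * ε ^ 2) * ((n : ℝ) * ∑ k, g k ^ 2) :=
            mul_le_mul_of_nonneg_left hB2 (by positivity)
        _ = δ * ∑ k, g k ^ 2 := by rw [hδ]; ring
    have herr' : δ * ∑ k, g k ^ 2 ≤ δ / θ * ip x₀ x₀ := by
      rw [div_mul_eq_mul_div, le_div_iff₀ hθ0]
      calc (δ * ∑ k, g k ^ 2) * θ = δ * (θ * ∑ k, g k ^ 2) := by ring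
        _ ≤ δ * ip x₀ x₀ := mul_le_mul_of_nonneg_left hipθ hδ0
    push_cast at hlow
    -- combine: (m_j − d_j + δ/θ) ip₀ ≥ 0
    have hkey : 0 ≤ (m j - d j + δ / θ) * ip x₀ x₀ := by nlinarith [hlow, hup, herr, herr']
    have := (mul_nonneg_iff_of_pos_right hippos).mp hkey
    linarith
  · ------------------------------------------------------------------ UPPER: m_j ≤ d_j + δ/θ
    -- u-side: a unit vector of span{u_0..u_j} orthogonal to v_0..v_{j-1} with E ≥ m_j
    obtain ⟨x, hxu, hx1, hxperp, hmE⟩ := exists_rayleigh_ge_of_constraints ip E u m hon hdiag hjn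
      (mlo := m j) (fun i hi => hm (show i ≤ j from Fin.le_def.mpr hi))
      (fun l : Fin (j : ℕ) => ip (v (Fin.castLE (le_of_lt hjn) l)))
    have hxv : x ∈ Submodule.span ℝ (Set.range v) := hspan_uv hxu
    obtain ⟨b, hb⟩ := (Submodule.mem_span_range_iff_exists_fun ℝ).mp hxv
    -- v-side data
    have hipx : ip x x = ∑ i, ∑ l, b i * b l * ip (v i) (v l) := by
      rw [← hb, bilin_sum_smul_sum_smul]
    have hEx : E x x = ∑ i, ∑ l, b i * b l * E (v i) (v l) := by
      rw [← hb, bilin_sum_smul_sum_smul]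
    have hcon : ∀ i : Fin n, i.val < (j : ℕ) → ∑ l, ip (v i) (v l) * b l = 0 := by
      intro i hi
      have h := hxperp ⟨i.val, hi⟩
      have hci : Fin.castLE (le_of_lt hjn) ⟨i.val, hi⟩ = i := Fin.ext rfl
      rw [hci, ← hb, bilin_sum_smul_right] at h
      rw [← h]
      exact Finset.sum_congr rfl fun l _ => by ring
    have hcons : ∀ i : Fin n, 0 < d i - d j → |b i| ≤ ε * ∑ l, |b l| := by
      intro i hi
      have hij : i.val < (j : ℕ) := by
        by_contra hc
        push Not at hc
        have : d i ≤ d j := hd_anti (Fin.le_def.mpr hc)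
        linarith
      exact abs_coeff_le_of_constraint (fun i l => ip (v i) (v l)) b ε hG' i (hcon i hij)
    have hupp := quadForm_upper_of_constraints (fun i l => E (v i) (v l)) (fun i l => ip (v i) (v l))
      d b (d j) ε τ σ hε hG' hS' (fun i => hσ i j) hcons
    have hgram := gram_lower (fun i l => ip (v i) (v l)) b ε hε hG'
    have hcs := sq_sum_abs_le_card_mul_sum_sq b
    simp only [Fintype.card_fin] at hupp hgram hcs
    have hX : ∑ i, ∑ l, b i * b l * (E (v i) (v l) - d j * ip (v i) (v l)) = E x x - d j * ip x x := by
      rw [hEx, hipx, Finset.mul_sum, ← Finset.sum_sub_distrib]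
      refine Finset.sum_congr rfl fun i _ => ?_
      rw [Finset.mul_sum, ← Finset.sum_sub_distrib]
      refine Finset.sum_congr rfl fun l _ => ?_
      ring
    rw [hX, hx1, mul_one] at hupp
    rw [← hipx, hx1] at hgram
    -- Σ b² ≤ 1/θ
    have hb2 : θ * ∑ i, b i ^ 2 ≤ 1 := by rw [hθ]; exact hgram
    have hsum0 : 0 ≤ ∑ i, b i ^ 2 := Finset.sum_nonneg fun i _ => sq_nonneg _
    have herr : (τ + 2 * σ * ε ^ 2 * (n : ℝ)) * (∑ i, |b i|) ^ 2 ≤ δ * ∑ i, b i ^ 2 := by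
      calc _ ≤ (τ + 2 * σ * ε ^ 2 * (n : ℝ)) * ((n : ℝ) * ∑ i, b i ^ 2) :=
            mul_le_mul_of_nonneg_left hcs (by positivity)
        _ = δ * ∑ i, b i ^ 2 := by rw [hδ]; ring
    have herr' : δ * ∑ i, b i ^ 2 ≤ δ / θ := by
      rw [le_div_iff₀ hθ0]
      calc (δ * ∑ i, b i ^ 2) * θ = δ * (θ * ∑ i, b i ^ 2) := by ring
        _ ≤ δ * 1 := mul_le_mul_of_nonneg_left hb2 hδ0
        _ = δ := mul_one δ
    linarith [hmE, hupp, herr, herr']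

end LemmaB

end Summit.QuantumFields.YangMills.Theorems.FemtoTransferGap.KTGen

end
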